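import Mathlib
import HarnessLib
import Literature.NumberTheory.GaloisRepresentations.ContinuousRep

/-!
# `MirrorPairReflection.MirrorCriterion` — preliminaries (support file 1/2 for stmt-Langlands-12835)

Elementary lemmas for the proof of the route item `MirrorPairReflection.MirrorCriterion`
(file `MirrorPairReflectionMirrorCriterion.lean`, via `…MirrorCriterionEndpoint.lean`):
* ultrametric bookkeeping: congruence modulo the open unit ball `‖x - y‖ < 1` of a
  non-archimedean normed field is an equivalence relation compatible with `+`, `-`, `*`;
* `not_split` (a representation with `r(g₀)` diagonal with distinct entries and some
  `r(g₁)₀₁ ≠ 0` is not diagonalisable) and `not_irreducible_of_stable_line` (`FramedRep`, `n = 2`);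
* `2 × 2` eigen-frames: `exists_frame_of_eigenvalues` (two distinct eigenvalues give a
  diagonalising frame), `exists_roots_cong` (integral roots labelled by their residues) and
  `exists_diagonal_frame`: for `σ : G → GL₂(F)` with `tr σ ≡ A + B` (`A`, `B` integral characters,
  `‖2‖ = 1`) and `A(g₀) ≢ B(g₀)`, a frame with `σ(g₀) = diag(l₁, l₂)`, `l₁ ≡ A(g₀)`, `l₂ ≡ B(g₀)`.
No definitions, no named facts. (decomp-langlands lens-6, g44.)
-/

set_option linter.dupNamespace false -- project-wide option (lakefile weak.linter.dupNamespace); `Summit.Langlands.Langlands` is the mandated namespace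

noncomputable section

namespace Summit.Langlands.Langlands.Theorems.MirrorPairReflectionMirrorCriterion

open Literature.NumberTheory.GaloisRepresentations
open scoped MatrixGroups Matrix

variable {F : Type*} [NormedField F] [IsUltrametricDist F]

/-- Ultrametric inequality for a difference. [folklore] -/
theorem norm_sub_le_max' (x y : F) : ‖x - y‖ ≤ max ‖x‖ ‖y‖ := by
  simpa [sub_eq_add_neg, norm_neg] using IsUltrametricDist.norm_add_le_max x (-y)

/-- The closed unit ball is closed under addition. [folklore] -/
theorem norm_add_le_one {x y : F} (hx : ‖x‖ ≤ 1) (hy : ‖y‖ ≤ 1) : ‖x + y‖ ≤ 1 :=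
  (IsUltrametricDist.norm_add_le_max x y).trans (max_le hx hy)

/-- The open unit ball is closed under addition. [folklore] -/
theorem norm_add_lt_one {x y : F} (hx : ‖x‖ < 1) (hy : ‖y‖ < 1) : ‖x + y‖ < 1 :=
  (IsUltrametricDist.norm_add_le_max x y).trans_lt (max_lt hx hy)

/-- The open unit ball is closed under subtraction. [folklore] -/
theorem norm_sub_lt_one {x y : F} (hx : ‖x‖ < 1) (hy : ‖y‖ < 1) : ‖x - y‖ < 1 :=
  (norm_sub_le_max' x y).trans_lt (max_lt hx hy)

omit [IsUltrametricDist F] in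
/-- Congruence modulo the open unit ball is symmetric. [folklore] -/
theorem cong_symm {x y : F} (h : ‖x - y‖ < 1) : ‖y - x‖ < 1 := by rwa [norm_sub_rev]

/-- Congruence modulo the open unit ball is transitive. [folklore] -/
theorem cong_trans {x y z : F} (h₁ : ‖x - y‖ < 1) (h₂ : ‖y - z‖ < 1) : ‖x - z‖ < 1 := by
  have e : x - z = (x - y) + (y - z) := by ring
  rw [e]; exact norm_add_lt_one h₁ h₂

/-- Congruences modulo the open unit ball add. [folklore] -/
theorem cong_add {x x' y y' : F} (hx : ‖x - x'‖ < 1) (hy : ‖y - y'‖ < 1) :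
    ‖(x + y) - (x' + y')‖ < 1 := by
  have e : (x + y) - (x' + y') = (x - x') + (y - y') := by ring
  rw [e]; exact norm_add_lt_one hx hy

/-- Congruences modulo the open unit ball subtract. [folklore] -/
theorem cong_sub {x x' y y' : F} (hx : ‖x - x'‖ < 1) (hy : ‖y - y'‖ < 1) :
    ‖(x - y) - (x' - y')‖ < 1 := by
  have e : (x - y) - (x' - y') = (x - x') - (y - y') := by ring
  rw [e]; exact norm_sub_lt_one hx hy

/-- Congruences modulo the open unit ball multiply (integral factors). [folklore] -/
theorem cong_mul {x x' y y' : F} (hx1 : ‖x‖ ≤ 1) (hy1 : ‖y'‖ ≤ 1) (hx : ‖x - x'‖ < 1)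
    (hy : ‖y - y'‖ < 1) : ‖x * y - x' * y'‖ < 1 := by
  have e : x * y - x' * y' = x * (y - y') + (x - x') * y' := by ring
  rw [e]
  refine norm_add_lt_one ?_ ?_
  · rw [norm_mul]; exact mul_lt_one_of_nonneg_of_lt_one_right hx1 (norm_nonneg _) hy
  · rw [norm_mul]; exact mul_lt_one_of_nonneg_of_lt_one_left (norm_nonneg _) hx hy1

/-- An element congruent to an integral element is integral. [folklore] -/
theorem norm_le_one_of_cong {x y : F} (hx : ‖x‖ ≤ 1) (h : ‖x - y‖ < 1) : ‖y‖ ≤ 1 := by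
  have e : y = x - (x - y) := by ring
  rw [e]; exact (norm_sub_le_max' _ _).trans (max_le hx h.le)

/-- An element congruent to a unit is a unit. [folklore] -/
theorem norm_eq_one_of_cong {x y : F} (hx : ‖x‖ = 1) (h : ‖x - y‖ < 1) : ‖y‖ = 1 := by
  refine le_antisymm (norm_le_one_of_cong hx.le h) ?_
  by_contra hy
  push Not at hy
  have e : x = y + (x - y) := by ring
  have : ‖x‖ < 1 := by rw [e]; exact norm_add_lt_one hy h
  exact absurd hx this.ne

/-- A `2`-dimensional representation with a non-split flag is not diagonalisable: if `r(g₀)` is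
diagonal with distinct entries and some `r(g₁)` has entry `(0,1) ≠ 0`, no frame makes all `r(g)`
diagonal. [folklore] -/
theorem not_split {G : Type*} [Group G] {k : Type*} [Field k] (r : G →* GL (Fin 2) k)
    {g₀ g₁ : G} (h01 : (r g₀).val 0 1 = 0) (h10 : (r g₀).val 1 0 = 0)
    (hne : (r g₀).val 0 0 ≠ (r g₀).val 1 1) (h1 : (r g₁).val 0 1 ≠ 0) :
    ¬ ∃ Q : GL (Fin 2) k, ∀ g, (Q * r g * Q⁻¹).val 0 1 = 0 ∧ (Q * r g * Q⁻¹).val 1 0 = 0 := by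
  rintro ⟨Q, hQ⟩
  have key : ∀ g, (r g).val * (Q⁻¹).val = (Q⁻¹).val * (Q * r g * Q⁻¹).val := by
    intro g
    rw [← Units.val_mul, ← Units.val_mul]
    congr 1
    rw [← mul_assoc, ← mul_assoc, inv_mul_cancel, one_mul]
  -- row identities `(r g S)₀ⱼ = (S Δ)₀ⱼ`, `(r g S)₁ⱼ = (S Δ)₁ⱼ` with `S = Q⁻¹`, `Δ = Q r(g) Q⁻¹`
  have row : ∀ g (i j : Fin 2), (r g).val i 0 * (Q⁻¹).val 0 j + (r g).val i 1 * (Q⁻¹).val 1 j =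
      (Q⁻¹).val i 0 * (Q * r g * Q⁻¹).val 0 j + (Q⁻¹).val i 1 * (Q * r g * Q⁻¹).val 1 j := by
    intro g i j
    have := congrFun (congrFun (key g) i) j
    simpa [Matrix.mul_apply, Fin.sum_univ_two] using this
  have hdet : (Q⁻¹).val 0 0 * (Q⁻¹).val 1 1 - (Q⁻¹).val 0 1 * (Q⁻¹).val 1 0 ≠ 0 := by
    rw [← Matrix.det_fin_two]
    exact (Matrix.isUnits_det_units (Q⁻¹)).ne_zero
  -- each column of `S = Q⁻¹` has a zero entry
  have col0 : (Q⁻¹).val 0 0 = 0 ∨ (Q⁻¹).val 1 0 = 0 := by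
    by_contra h
    push Not at h
    have r0 := row g₀ 0 0
    have r1 := row g₀ 1 0
    rw [h01] at r0
    rw [h10] at r1
    simp only [Fin.isValue, (hQ g₀).2, mul_zero, add_zero, zero_mul, zero_add] at r0 r1
    apply hne
    have e0 : (r g₀).val 0 0 = (Q * r g₀ * Q⁻¹).val 0 0 :=
      mul_right_cancel₀ h.1 (by rw [r0, mul_comm])
    have e1 : (r g₀).val 1 1 = (Q * r g₀ * Q⁻¹).val 0 0 :=
      mul_right_cancel₀ h.2 (by rw [r1, mul_comm])
    rw [e0, e1]
  have col1 : (Q⁻¹).val 0 1 = 0 ∨ (Q⁻¹).val 1 1 = 0 := by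
    by_contra h
    push Not at h
    have r0 := row g₀ 0 1
    have r1 := row g₀ 1 1
    rw [h01] at r0
    rw [h10] at r1
    simp only [Fin.isValue, (hQ g₀).1, mul_zero, add_zero, zero_mul, zero_add] at r0 r1
    apply hne
    have e0 : (r g₀).val 0 0 = (Q * r g₀ * Q⁻¹).val 1 1 :=
      mul_right_cancel₀ h.1 (by rw [r0, mul_comm])
    have e1 : (r g₀).val 1 1 = (Q * r g₀ * Q⁻¹).val 1 1 :=
      mul_right_cancel₀ h.2 (by rw [r1, mul_comm])
    rw [e0, e1]
  -- a column of the form `(0, s)`, `s ≠ 0`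
  have hcol : ((Q⁻¹).val 0 0 = 0 ∧ (Q⁻¹).val 1 0 ≠ 0) ∨
      ((Q⁻¹).val 0 1 = 0 ∧ (Q⁻¹).val 1 1 ≠ 0) := by
    by_cases h00 : (Q⁻¹).val 0 0 = 0
    · refine Or.inl ⟨h00, fun h10' => hdet ?_⟩
      rw [h00, h10']; ring
    · have h10' : (Q⁻¹).val 1 0 = 0 := col0.resolve_left h00
      have h11 : (Q⁻¹).val 1 1 ≠ 0 := fun h11 => hdet (by rw [h10', h11]; ring)
      exact Or.inr ⟨col1.resolve_right h11, h11⟩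
  -- then `r(g)₀₁ = 0` for all `g`
  have hzero : ∀ g, (r g).val 0 1 = 0 := by
    intro g
    rcases hcol with ⟨h0, hne0⟩ | ⟨h0, hne0⟩
    · have r0 := row g 0 0
      simp only [Fin.isValue, h0, (hQ g).2, mul_zero, zero_add, zero_mul, add_zero] at r0
      exact (mul_eq_zero.1 r0).resolve_right hne0
    · have r0 := row g 0 1
      simp only [Fin.isValue, h0, (hQ g).1, mul_zero, zero_add, zero_mul, add_zero] at r0
      exact (mul_eq_zero.1 r0).resolve_right hne0
  exact h1 (hzero g₁)

/-- A line stable under all `σ(g)` contradicts irreducibility (dimension `2`). [folklore] -/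
theorem not_irreducible_of_stable_line {G : Type*} [Group G] [TopologicalSpace G]
    {K : Type*} [Field K] [TopologicalSpace K] (σ : G →ₜ* GL (Fin 2) K) {v : Fin 2 → K}
    (hv : v ≠ 0) (hstab : ∀ g, ∃ t : K, (σ g).val *ᵥ v = t • v) :
    ¬ FramedRep.IsIrreducible σ := by
  intro hirr
  have hirr' : IsSimpleOrder (Subrepresentation (FramedRep.toRepresentation σ)) := hirr
  let W : Subrepresentation (FramedRep.toRepresentation σ) :=
    ⟨K ∙ v, fun g w hw => by
      obtain ⟨c, rfl⟩ := Submodule.mem_span_singleton.mp hw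
      obtain ⟨t, ht⟩ := hstab g
      rw [FramedRep.toRepresentation_apply_apply, Matrix.mulVec_smul]
      change c • ((σ g).val *ᵥ v) ∈ K ∙ v
      rw [ht, smul_smul]
      exact Submodule.mem_span_singleton.mpr ⟨c * t, rfl⟩⟩
  rcases hirr'.eq_bot_or_eq_top W with h0 | h1
  · have : v ∈ W.toSubmodule := Submodule.mem_span_singleton_self v
    rw [h0] at this
    exact hv ((Submodule.mem_bot K).mp this)
  · have hmem : ∀ w : Fin 2 → K, w ∈ (K ∙ v) := fun w => by
      have : w ∈ (⊤ : Subrepresentation (FramedRep.toRepresentation σ)).toSubmodule :=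
        Submodule.mem_top
      rw [← h1] at this
      exact this
    obtain ⟨c₀, hc₀⟩ := Submodule.mem_span_singleton.mp (hmem (Pi.single 0 1))
    obtain ⟨c₁, hc₁⟩ := Submodule.mem_span_singleton.mp (hmem (Pi.single 1 1))
    have h0' : c₀ * v 1 = 0 := by have := congrFun hc₀ 1; simpa using this
    have h1' : c₁ * v 0 = 0 := by have := congrFun hc₁ 0; simpa using this
    have hc₀0 : c₀ ≠ 0 := by
      rintro rfl; have := congrFun hc₀ 0; simp at this
    have hc₁0 : c₁ ≠ 0 := by
      rintro rfl; have := congrFun hc₁ 1; simp at this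
    apply hv; ext i; fin_cases i
    · exact (mul_eq_zero.mp h1').resolve_left hc₁0
    · exact (mul_eq_zero.mp h0').resolve_left hc₀0

/-- A root of the characteristic polynomial `x² - tr(N) x + det(N)` of a `2 × 2` matrix `N` is an
eigenvalue: `det (N - x) = 0`. [folklore] -/
theorem det_sub_smul_one_eq_zero {K : Type*} [CommRing K] (N : Matrix (Fin 2) (Fin 2) K) {x : K}
    (hx : x * x - N.trace * x + N.det = 0) :
    (N - x • (1 : Matrix (Fin 2) (Fin 2) K)).det = 0 := by
  have e1 : N.trace = N 0 0 + N 1 1 := Matrix.trace_fin_two N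
  have e2 : N.det = N 0 0 * N 1 1 - N 0 1 * N 1 0 := Matrix.det_fin_two N
  rw [Matrix.det_fin_two]
  simp only [Matrix.sub_apply, Matrix.smul_apply, Matrix.one_apply_eq, smul_eq_mul, mul_one,
    Matrix.one_apply_ne (show (0 : Fin 2) ≠ 1 by decide),
    Matrix.one_apply_ne (show (1 : Fin 2) ≠ 0 by decide), mul_zero, sub_zero]
  linear_combination hx + x * e1 - e2

/-- The two scalar equations expressing `(N - x) v = 0` for a `2 × 2` matrix. [folklore] -/
theorem eigen_eqs {K : Type*} [CommRing K] {N : Matrix (Fin 2) (Fin 2) K} {x : K} {v : Fin 2 → K}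
    (hv : (N - x • (1 : Matrix (Fin 2) (Fin 2) K)) *ᵥ v = 0) :
    N 0 0 * v 0 + N 0 1 * v 1 = x * v 0 ∧ N 1 0 * v 0 + N 1 1 * v 1 = x * v 1 := by
  have h0 := congrFun hv 0
  have h1 := congrFun hv 1
  simp only [Matrix.mulVec, dotProduct, Fin.sum_univ_two, Matrix.sub_apply, Matrix.smul_apply,
    Matrix.one_apply_eq, Matrix.one_apply_ne (show (0 : Fin 2) ≠ 1 by decide),
    Matrix.one_apply_ne (show (1 : Fin 2) ≠ 0 by decide), smul_eq_mul, mul_one, mul_zero,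
    sub_zero, Pi.zero_apply] at h0 h1
  constructor
  · linear_combination h0
  · linear_combination h1

/-- A `2 × 2` matrix over a field with two distinct eigenvalues `l₁ ≠ l₂` is diagonalised by a
frame of eigenvectors: `N Q = Q diag(l₁, l₂)` for some invertible `Q`. [folklore] -/
theorem exists_frame_of_eigenvalues {K : Type*} [Field K] (N : Matrix (Fin 2) (Fin 2) K)
    {l₁ l₂ : K} (hne : l₁ ≠ l₂) (h₁ : (N - l₁ • (1 : Matrix (Fin 2) (Fin 2) K)).det = 0)
    (h₂ : (N - l₂ • (1 : Matrix (Fin 2) (Fin 2) K)).det = 0) :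
    ∃ Q : GL (Fin 2) K, N * Q.val = Q.val * Matrix.diagonal ![l₁, l₂] := by
  classical
  have nz : ∀ {v : Fin 2 → K}, v ≠ 0 → v 0 ≠ 0 ∨ v 1 ≠ 0 := by
    intro v hv
    by_contra h
    push Not at h
    exact hv (funext fun i => by fin_cases i <;> simp [h.1, h.2])
  obtain ⟨v₁, hv₁0, hv₁⟩ := Matrix.exists_mulVec_eq_zero_iff.2 h₁
  obtain ⟨v₂, hv₂0, hv₂⟩ := Matrix.exists_mulVec_eq_zero_iff.2 h₂
  obtain ⟨e11, e12⟩ := eigen_eqs hv₁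
  obtain ⟨e21, e22⟩ := eigen_eqs hv₂
  have hQdet : (!![v₁ 0, v₂ 0; v₁ 1, v₂ 1] : Matrix (Fin 2) (Fin 2) K).det ≠ 0 := by
    rw [Matrix.det_fin_two_of]
    intro hd
    have hsub : l₁ - l₂ ≠ 0 := sub_ne_zero.2 hne
    have k1 : (l₁ - l₂) * (v₁ 0 * v₂ 0) = 0 := by
      linear_combination (-(v₂ 0)) * e11 + (v₁ 0) * e21 - (N 0 1) * hd
    have k2 : (l₁ - l₂) * (v₁ 1 * v₂ 1) = 0 := by
      linear_combination (-(v₂ 1)) * e12 + (v₁ 1) * e22 + (N 1 0) * hd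
    have k1' : v₁ 0 * v₂ 0 = 0 := (mul_eq_zero.1 k1).resolve_left hsub
    have k2' : v₁ 1 * v₂ 1 = 0 := (mul_eq_zero.1 k2).resolve_left hsub
    rcases mul_eq_zero.1 k1' with h10 | h20
    · have h11 : v₁ 1 ≠ 0 := (nz hv₁0).resolve_left (not_not.2 h10)
      have h20 : v₂ 0 = 0 := by
        rw [h10, zero_mul, zero_sub, neg_eq_zero] at hd
        exact (mul_eq_zero.1 hd).resolve_right h11
      have h21 : v₂ 1 = 0 := (mul_eq_zero.1 k2').resolve_left h11
      rcases nz hv₂0 with h | h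
      · exact h h20
      · exact h h21
    · have h21 : v₂ 1 ≠ 0 := (nz hv₂0).resolve_left (not_not.2 h20)
      have h10 : v₁ 0 = 0 := by
        rw [h20, zero_mul, sub_zero] at hd
        exact (mul_eq_zero.1 hd).resolve_right h21
      have h11 : v₁ 1 = 0 := (mul_eq_zero.1 k2').resolve_right h21
      rcases nz hv₁0 with h | h
      · exact h h10
      · exact h h11
  refine ⟨Matrix.GeneralLinearGroup.mkOfDetNeZero _ hQdet, ?_⟩
  show N * !![v₁ 0, v₂ 0; v₁ 1, v₂ 1] = !![v₁ 0, v₂ 0; v₁ 1, v₂ 1] * Matrix.diagonal ![l₁, l₂]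
  ext i j
  fin_cases i <;> fin_cases j
  · simp [Matrix.mul_apply, Fin.sum_univ_two]
    linear_combination e11
  · simp [Matrix.mul_apply, Fin.sum_univ_two]
    linear_combination e21
  · simp [Matrix.mul_apply, Fin.sum_univ_two]
    linear_combination e12
  · simp [Matrix.mul_apply, Fin.sum_univ_two]
    linear_combination e22

/-- **Labelled integral roots.**  In an algebraically closed non-archimedean field, if `t`, `d`
are integral with `t ≡ A₀ + B₀`, `d ≡ A₀ B₀` modulo the open unit ball and `‖A₀ - B₀‖ = 1`, then
`x² - t x + d` has integral roots `l₁ ≡ A₀` and `l₂ = t - l₁ ≡ B₀`, with `‖l₁ - l₂‖ = 1`.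
[folklore] -/
theorem exists_roots_cong [IsAlgClosed F] [NeZero (2 : F)] {t d A₀ B₀ : F} (ht : ‖t‖ ≤ 1)
    (hd : ‖d‖ ≤ 1)
    (htc : ‖t - (A₀ + B₀)‖ < 1) (hdc : ‖d - A₀ * B₀‖ < 1) (hAB : ‖A₀ - B₀‖ = 1) :
    ∃ l₁ l₂ : F, l₁ * l₁ - t * l₁ + d = 0 ∧ l₂ * l₂ - t * l₂ + d = 0 ∧
      ‖l₁‖ ≤ 1 ∧ ‖l₂‖ ≤ 1 ∧ ‖l₁ - A₀‖ < 1 ∧ ‖l₂ - B₀‖ < 1 ∧ ‖l₁ - l₂‖ = 1 := by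
  have root_int : ∀ x : F, x * x - t * x + d = 0 → ‖x‖ ≤ 1 := by
    intro x hx
    by_contra hgt
    push Not at hgt
    have hx0 : 0 < ‖x‖ := zero_lt_one.trans hgt
    have hxx : x * x = t * x - d := by linear_combination hx
    have i1 : ‖t * x‖ < ‖x‖ * ‖x‖ := by
      rw [norm_mul]
      calc ‖t‖ * ‖x‖ ≤ 1 * ‖x‖ := by gcongr
        _ = ‖x‖ := one_mul _
        _ < ‖x‖ * ‖x‖ := lt_mul_of_one_lt_right hx0 hgt
    have i2 : ‖d‖ < ‖x‖ * ‖x‖ :=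
      calc ‖d‖ ≤ 1 := hd
        _ < ‖x‖ * ‖x‖ := one_lt_mul_of_lt_of_le hgt hgt.le
    have : ‖x * x‖ < ‖x‖ * ‖x‖ := by
      rw [hxx]; exact (norm_sub_le_max' _ _).trans_lt (max_lt i1 i2)
    rw [norm_mul] at this
    exact lt_irrefl _ this
  have prod_cong : ∀ x : F, x * x - t * x + d = 0 → ‖(x - A₀) * (x - B₀)‖ < 1 := by
    intro x hx
    have e : (x - A₀) * (x - B₀) = (t - (A₀ + B₀)) * x - (d - A₀ * B₀) := by
      linear_combination hx
    rw [e]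
    refine norm_sub_lt_one ?_ hdc
    rw [norm_mul]
    exact mul_lt_one_of_nonneg_of_lt_one_left (norm_nonneg _) htc (root_int x hx)
  obtain ⟨lam, hlam⟩ : ∃ x : F, x * x - t * x + d = 0 := by
    obtain ⟨s, hs⟩ := IsAlgClosed.exists_eq_mul_self (discrim (1 : F) (-t) d)
    obtain ⟨x, hx⟩ := exists_quadratic_eq_zero (a := (1 : F)) (b := -t) (c := d) one_ne_zero
      ⟨s, hs⟩
    exact ⟨x, by linear_combination hx⟩
  obtain ⟨l₁, hl₁root, hl₁A⟩ : ∃ x : F, x * x - t * x + d = 0 ∧ ‖x - A₀‖ < 1 := by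
    by_cases h : ‖lam - A₀‖ < 1
    · exact ⟨lam, hlam, h⟩
    · refine ⟨t - lam, by linear_combination hlam, ?_⟩
      have hBl : ‖lam - B₀‖ < 1 := by
        have hp' := prod_cong lam hlam
        rw [norm_mul] at hp'
        push Not at h
        by_contra hb
        push Not at hb
        exact absurd hp' (not_lt.2 (one_le_mul_of_one_le_of_one_le h hb))
      have e : t - lam - A₀ = (t - (A₀ + B₀)) - (lam - B₀) := by ring
      rw [e]; exact norm_sub_lt_one htc hBl
  have hl₂root : (t - l₁) * (t - l₁) - t * (t - l₁) + d = 0 := by linear_combination hl₁root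
  have hl₂B : ‖(t - l₁) - B₀‖ < 1 := by
    have e : (t - l₁) - B₀ = (t - (A₀ + B₀)) - (l₁ - A₀) := by ring
    rw [e]; exact norm_sub_lt_one htc hl₁A
  refine ⟨l₁, t - l₁, hl₁root, hl₂root, root_int _ hl₁root, root_int _ hl₂root, hl₁A, hl₂B, ?_⟩
  refine norm_eq_one_of_cong hAB ?_
  have e : (A₀ - B₀) - (l₁ - (t - l₁)) = ((t - l₁) - B₀) - (l₁ - A₀) := by ring
  rw [e]; exact norm_sub_lt_one hl₂B hl₁A

/-- **The eigen-frame at `g₀`.**  For `σ : G → GL₂(F)` (`F` algebraically closed,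
non-archimedean, `‖2‖ = 1`) with `tr σ ≡ A + B` for integral characters `A`, `B` and
`‖A(g₀) - B(g₀)‖ = 1`: `tr σ` and `det σ ≡ AB` are integral (`2 det = tr² - tr ∘ sq`), and
`σ(g₀)` is diagonalised, `σ(g₀) Q₀ = Q₀ diag(l₁, l₂)`, with `lᵢ` integral, `l₁ ≡ A(g₀)`,
`l₂ ≡ B(g₀)`, `‖l₁ - l₂‖ = 1`. [folklore] -/
theorem exists_diagonal_frame [IsAlgClosed F] {G : Type*} [Group G] (σ : G →* GL (Fin 2) F)
    (A B : G →* F) (hA : ∀ g, ‖A g‖ ≤ 1) (hB : ∀ g, ‖B g‖ ≤ 1) (h2 : ‖(2 : F)‖ = 1) {g₀ : G}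
    (hg₀ : ‖A g₀ - B g₀‖ = 1) (hT : ∀ g, ‖(σ g).val.trace - (A g + B g)‖ < 1) :
    ∃ (Q₀ : GL (Fin 2) F) (l₁ l₂ : F), ‖l₁‖ ≤ 1 ∧ ‖l₂‖ ≤ 1 ∧ ‖l₁ - A g₀‖ < 1 ∧
      ‖l₂ - B g₀‖ < 1 ∧ ‖l₁ - l₂‖ = 1 ∧
      (σ g₀).val * Q₀.val = Q₀.val * Matrix.diagonal ![l₁, l₂] := by
  classical
  haveI : NeZero (2 : F) := ⟨fun h => by rw [h, norm_zero] at h2; exact zero_ne_one h2⟩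
  have hAB : ∀ g, ‖A g + B g‖ ≤ 1 := fun g => norm_add_le_one (hA g) (hB g)
  have htr : ∀ g, ‖(σ g).val.trace‖ ≤ 1 := fun g => norm_le_one_of_cong (hAB g) (cong_symm (hT g))
  have trace_sq : ∀ N : Matrix (Fin 2) (Fin 2) F,
      N.trace * N.trace - (N * N).trace = 2 * N.det := fun N => by
    simp only [Matrix.trace_fin_two, Matrix.det_fin_two, Matrix.mul_apply, Fin.sum_univ_two]
    ring
  have hdetc : ∀ g, ‖(σ g).val.det - A g * B g‖ < 1 := fun g => by
    have e1 : ‖(σ g).val.trace * (σ g).val.trace - (A g + B g) * (A g + B g)‖ < 1 :=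
      cong_mul (htr g) (hAB g) (hT g) (hT g)
    have e3 := cong_sub e1 (hT (g * g))
    have hid : (σ g).val.trace * (σ g).val.trace - (σ (g * g)).val.trace = 2 * (σ g).val.det := by
      rw [map_mul, Units.val_mul]; exact trace_sq _
    have hid2 : (A g + B g) * (A g + B g) - (A (g * g) + B (g * g)) = 2 * (A g * B g) := by
      rw [map_mul, map_mul]; ring
    rw [hid, hid2, ← mul_sub, norm_mul, h2, one_mul] at e3
    exact e3
  have hdet1 : ∀ g, ‖(σ g).val.det‖ ≤ 1 := fun g =>
    norm_le_one_of_cong (by rw [norm_mul]; exact mul_le_one₀ (hA g) (norm_nonneg _) (hB g))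
      (cong_symm (hdetc g))
  obtain ⟨l₁, l₂, h1, h2', hl1, hl2, hl₁A, hl₂B, hl12⟩ :=
    exists_roots_cong (htr g₀) (hdet1 g₀) (hT g₀) (hdetc g₀) hg₀
  have hne : l₁ ≠ l₂ := by
    intro h; rw [h, sub_self, norm_zero] at hl12; exact zero_ne_one hl12
  obtain ⟨Q₀, hQ₀⟩ := exists_frame_of_eigenvalues (σ g₀).val hne
    (det_sub_smul_one_eq_zero _ h1) (det_sub_smul_one_eq_zero _ h2')
  exact ⟨Q₀, l₁, l₂, hl1, hl2, hl₁A, hl₂B, hl12, hQ₀⟩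

end Summit.Langlands.Langlands.Theorems.MirrorPairReflectionMirrorCriterion

end
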